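import Summits.Ventures.PercRepro.SixThreeShares

/-!
# PercRepro — the exact pair bound for an independent triple: `D(T ∪ {x, x′}) ≤ 15` (p2, gen 6)

mine-2's `MINE2-RLS.md` §19.2 (c) for `b = 3`: with `T` an independent triple in a plane `G` and `x ≠ x′ ∉ G`, the
denominator of the pair witness `S = T ∪ {x, x′}` is one of `10, 12, 15` (θ = 6).  The inequality half `D(S) ≤ 15` is
what the lossy-pair accounting of Theorem P₁ (§19.4) needs (share `≥ 1/15`); it sharpens `share_triple_ge`'s crude
`1/22`.  Ingredients:

* a line `L` of `M|T` is COPLANAR with `{x, x′}` when `x′ ∈ cl(L ∪ {x})`; its fibre (the planes `P ≠ G` with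
  `P ∩ T = L ∩ T`) contributes `≤ 6` (`pair_fibre_le`), a non-coplanar line `≤ 2` (`pair_fibre_le_of_no_both`);
* two distinct coplanar lines through a point `a` of `T` force `a ∈ cl({x, x′})` (`mem_closure_of_two_coplanar`), so
  not all three lines are coplanar (`not_all_coplanar`: `T ⊆ cl({x, x′})` would give `ρ(T) ≤ 2`);
* a coplanar line kills the point-planes `cl({a, x, x′})` at its two points (`P = cl(L ∪ {x})` would meet `T` in two
  points);
* the count: `|C|` coplanar lines give `≤ 6|C| + 2(3 − |C|)` from the lines and `≤ 3, 1, 0` point-planes for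
  `|C| = 0, 1, 2`, hence `D(S) ≤ 1 + 14`.
-/

namespace PercRepro

namespace SixThree

open Finset ThmH

variable {α : Type*} [DecidableEq α] {M : Matroid α} [M.Finite]

/-- An independent triple has exactly three lines in `M|T`, each meeting `T` in two points. -/
theorem linesOf_triple (hs : Simple M) {T : Finset α} (hT : T ⊆ gr M) (hrT : M.eRk (T : Set α) = 3)
    (hT3 : T.card = 3) : (linesOf M T).card = 3 ∧ ∀ L ∈ linesOf M T, (L ∩ T).card = 2 := by
  have hk : ∀ L ∈ linesOf M T, (L ∩ T).card = 2 := by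
    intro L hL
    have h1 := card_inter_le_of_linesOf hrT hL
    have h2 : 2 ≤ (L ∩ T).card := (Finset.mem_filter.1 hL).2
    omega
  refine ⟨?_, hk⟩
  have hsum := sum_choose_linesOf hs hT
  rw [hT3, show Nat.choose 3 2 = 3 by decide] at hsum
  rw [Finset.sum_congr rfl (fun L hL => by rw [hk L hL])] at hsum
  simpa using hsum

/-- The two lines `cl({a, b})`, `cl({a, c})` of an independent triple `T = {a, b, c}` through `a` are distinct
members of `linesOf M T` containing `a`. -/
theorem two_lines_through (hs : Simple M) {T : Finset α} (hT : T ⊆ gr M) (hrT : M.eRk (T : Set α) = 3)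
    {a b c : α} (hab : a ≠ b) (hac : a ≠ c) (hbc : b ≠ c) (hTabc : T = {a, b, c}) :
    ∃ L₁ ∈ linesOf M T, ∃ L₂ ∈ linesOf M T, L₁ ≠ L₂ ∧ a ∈ L₁ ∧ a ∈ L₂ := by
  have hab' : ({a, b} : Finset α) ⊆ T := by
    rw [hTabc]; intro y hy; simp only [Finset.mem_insert, Finset.mem_singleton] at hy ⊢; tauto
  have hac' : ({a, c} : Finset α) ⊆ T := by
    rw [hTabc]; intro y hy; simp only [Finset.mem_insert, Finset.mem_singleton] at hy ⊢; tauto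
  obtain ⟨hL₁, hsub₁⟩ := clF_pair_mem_linesOf hs hT hab' (Finset.card_pair hab)
  obtain ⟨hL₂, hsub₂⟩ := clF_pair_mem_linesOf hs hT hac' (Finset.card_pair hac)
  refine ⟨_, hL₁, _, hL₂, ?_, hsub₁ (by simp), hsub₂ (by simp)⟩
  intro heq
  -- the common line would contain `a, b, c`, so `ρ(T) ≤ 2`
  have hTsub : T ⊆ clF M {a, b} := by
    rw [hTabc]
    intro y hy
    simp only [Finset.mem_insert, Finset.mem_singleton] at hy
    rcases hy with rfl | rfl | rfl
    · exact hsub₁ (by simp)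
    · exact hsub₁ (by simp)
    · rw [heq]; exact hsub₂ (by simp)
  have hL₁' : clF M {a, b} ∈ lines M := (Finset.mem_filter.1 hL₁).1
  have := M.eRk_mono (Finset.coe_subset.2 hTsub)
  rw [hrT, (mem_lines.1 hL₁').2.2] at this
  exact absurd this (by decide)

/-- **Two coplanar lines through a point.**  If `L₁ ≠ L₂` are lines of `M|T` (`T ⊆ G` of rank `3`) through `a`,
both coplanar with `{x, x′}` (`x′ ∈ cl(L_i ∪ {x})`), then `a ∈ cl({x, x′})`. -/
theorem mem_closure_of_two_coplanar (hs : Simple M) {G T L₁ L₂ : Finset α} (hG : G ∈ planes M) (hT : T ⊆ G)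
    (hrT : M.eRk (T : Set α) = 3) (hL₁ : L₁ ∈ linesOf M T) (hL₂ : L₂ ∈ linesOf M T) (hne : L₁ ≠ L₂)
    {a : α} (ha₁ : a ∈ L₁) (ha₂ : a ∈ L₂) {x x' : α} (hx : x ∈ gr M) (hx' : x' ∈ gr M) (hxx' : x ≠ x')
    (hxG : x ∉ G) (hc₁ : x' ∈ clF M (insert x L₁)) (hc₂ : x' ∈ clF M (insert x L₂)) :
    a ∈ M.closure ({x, x'} : Set α) := by
  have hTg : T ⊆ gr M := hT.trans (mem_planes.1 hG).1
  have hL₁' : L₁ ∈ lines M := (Finset.mem_filter.1 hL₁).1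
  have hL₂' : L₂ ∈ lines M := (Finset.mem_filter.1 hL₂).1
  have hL₁G := linesOf_subset_plane hs hG hT hrT hL₁
  have hL₂G := linesOf_subset_plane hs hG hT hrT hL₂
  have hc₁' : 2 ≤ L₁.card := (Finset.mem_filter.1 hL₁).2.trans (Finset.card_le_card Finset.inter_subset_left)
  have hc₂' : 2 ≤ L₂.card := (Finset.mem_filter.1 hL₂).2.trans (Finset.card_le_card Finset.inter_subset_left)
  have hr₁ : M.eRk ((insert x L₁ : Finset α) : Set α) = 3 :=
    eRk_insert_eq_three hs hL₁' (Finset.Subset.refl _) hc₁' hx (fun h => hxG (hL₁G h))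
  have hr₂ : M.eRk ((insert x L₂ : Finset α) : Set α) = 3 :=
    eRk_insert_eq_three hs hL₂' (Finset.Subset.refl _) hc₂' hx (fun h => hxG (hL₂G h))
  have hsub₁ : insert x L₁ ⊆ gr M := Finset.insert_subset hx ((mem_lines.1 hL₁').1)
  have hsub₂ : insert x L₂ ⊆ gr M := Finset.insert_subset hx ((mem_lines.1 hL₂').1)
  obtain ⟨hP₁, hP₁sub⟩ := clF_mem_planes hsub₁ hr₁
  obtain ⟨hP₂, hP₂sub⟩ := clF_mem_planes hsub₂ hr₂
  -- the two planes are distinct: a common plane would contain `L₁ ∪ L₂ ⊇` two points of each line … and `G`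
  have hPne : clF M (insert x L₁) ≠ clF M (insert x L₂) := by
    intro heq
    -- `L₁ ∪ L₂ ⊆ P₁`; the line `L₂` meets `T` in a point `b ∉ L₁`, so `P₁ ⊇ L₁ ∪ {b}` of rank `3` inside `G` ⇒ `P₁ = G ∋ x`
    have hL₂P : L₂ ⊆ clF M (insert x L₁) := by
      rw [heq]; exact (Finset.subset_insert _ _).trans hP₂sub
    have hL₁P : L₁ ⊆ clF M (insert x L₁) := (Finset.subset_insert _ _).trans hP₁sub
    obtain ⟨b, hbL₂, hbL₁⟩ : ∃ b ∈ L₂ ∩ T, b ∉ L₁ := by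
      by_contra h
      push Not at h
      -- then `L₂ ∩ T ⊆ L₁`, two points of `L₂` in `L₁` ⇒ `L₁ = L₂`
      obtain ⟨u, hu, v, hv, huv⟩ := Finset.one_lt_card.1 (Finset.mem_filter.1 hL₂).2
      exact hne (lines_eq_of_two_mem hs hL₁' hL₂' (h u hu) (h v hv) (Finset.mem_inter.1 hu).1
        (Finset.mem_inter.1 hv).1 huv)
    have hr3 : M.eRk ((insert b L₁ : Finset α) : Set α) = 3 :=
      eRk_insert_eq_three hs hL₁' (Finset.Subset.refl _) hc₁' (hTg (Finset.mem_inter.1 hbL₂).2) hbL₁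
    have hsubP : insert b L₁ ⊆ clF M (insert x L₁) := Finset.insert_subset (hL₂P (Finset.mem_inter.1 hbL₂).1) hL₁P
    have hsubG : insert b L₁ ⊆ G := Finset.insert_subset (hT (Finset.mem_inter.1 hbL₂).2) hL₁G
    have := planes_eq_of_subset hP₁ hG hsubP hsubG hr3
    exact hxG (this ▸ hP₁sub (Finset.mem_insert_self _ _))
  -- `{a, x, x′} ⊆ P₁ ∩ P₂`, which has rank `≤ 2`
  have hsub : ({a, x, x'} : Finset α) ⊆ clF M (insert x L₁) ∩ clF M (insert x L₂) := by
    intro y hy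
    simp only [Finset.mem_insert, Finset.mem_singleton] at hy
    rw [Finset.mem_inter]
    rcases hy with rfl | rfl | rfl
    · exact ⟨hP₁sub (Finset.mem_insert_of_mem ha₁), hP₂sub (Finset.mem_insert_of_mem ha₂)⟩
    · exact ⟨hP₁sub (Finset.mem_insert_self _ _), hP₂sub (Finset.mem_insert_self _ _)⟩
    · exact ⟨hc₁, hc₂⟩
  have hle2 : M.eRk (({a, x, x'} : Finset α) : Set α) ≤ 2 :=
    (M.eRk_mono (Finset.coe_subset.2 hsub)).trans (eRk_inter_le_two_of_ne hP₁ hP₂ hPne)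
  -- hence `a ∈ cl({x, x′})`: otherwise `ρ({a, x, x′}) = ρ({x, x′}) + 1 = 3`
  by_contra hnot
  have haE : a ∈ M.E := by rw [← coe_gr M]; exact_mod_cast (mem_lines.1 hL₁').1 ha₁
  have hxE : x ∈ M.E := by rw [← coe_gr M]; exact_mod_cast hx
  have hx'E : x' ∈ M.E := by rw [← coe_gr M]; exact_mod_cast hx'
  have hr2 : M.eRk ({x, x'} : Set α) = 2 := hs x hxE x' hx'E hxx'
  have := M.eRk_insert_eq_add_one (e := a) (X := ({x, x'} : Set α)) ⟨haE, hnot⟩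
  rw [hr2] at this
  have hcoe : (({a, x, x'} : Finset α) : Set α) = insert a ({x, x'} : Set α) := by
    push_cast; rfl
  rw [hcoe, this] at hle2
  exact absurd hle2 (by decide)

/-- **Not all three lines of an independent triple are coplanar with `{x, x′}`.** -/
theorem not_all_coplanar (hs : Simple M) {G T : Finset α} (hG : G ∈ planes M) (hT : T ⊆ G)
    (hrT : M.eRk (T : Set α) = 3) (hT3 : T.card = 3) {x x' : α} (hx : x ∈ gr M) (hx' : x' ∈ gr M)
    (hxx' : x ≠ x') (hxG : x ∉ G) : ¬ (∀ L ∈ linesOf M T, x' ∈ clF M (insert x L)) := by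
  intro hall
  have hTg : T ⊆ gr M := hT.trans (mem_planes.1 hG).1
  obtain ⟨a, b, c, hab, hac, hbc, hTabc⟩ := Finset.card_eq_three.1 hT3
  -- every point of `T` lies in `cl({x, x′})`
  have hpt : ∀ p ∈ T, p ∈ M.closure ({x, x'} : Set α) := by
    intro p hp
    rw [hTabc] at hp
    simp only [Finset.mem_insert, Finset.mem_singleton] at hp
    have key : ∀ (u v w : α), u ≠ v → u ≠ w → v ≠ w → T = {u, v, w} → u ∈ M.closure ({x, x'} : Set α) := by
      intro u v w huv huw hvw hTuvw
      obtain ⟨L₁, hL₁, L₂, hL₂, hne, hu₁, hu₂⟩ := two_lines_through hs hTg hrT huv huw hvw hTuvw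
      exact mem_closure_of_two_coplanar hs hG hT hrT hL₁ hL₂ hne hu₁ hu₂ hx hx' hxx' hxG
        (hall L₁ hL₁) (hall L₂ hL₂)
    rcases hp with rfl | rfl | rfl
    · exact key p b c hab hac hbc hTabc
    · exact key p a c hab.symm hbc hac (by rw [hTabc]; ext y; simp only [Finset.mem_insert, Finset.mem_singleton]; tauto)
    · exact key p a b hac.symm hbc.symm hab (by rw [hTabc]; ext y; simp only [Finset.mem_insert, Finset.mem_singleton]; tauto)
  have hTsub : (T : Set α) ⊆ M.closure ({x, x'} : Set α) := fun p hp => hpt p (by exact_mod_cast hp)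
  have hxE : x ∈ M.E := by rw [← coe_gr M]; exact_mod_cast hx
  have hx'E : x' ∈ M.E := by rw [← coe_gr M]; exact_mod_cast hx'
  have hr2 : M.eRk ({x, x'} : Set α) = 2 := hs x hxE x' hx'E hxx'
  have := M.eRk_mono hTsub
  rw [M.eRk_closure_eq, hr2, hrT] at this
  exact absurd this (by decide)

/-- A coplanar line kills the point-planes at its points: if `L ∈ linesOf M T` with `x′ ∈ cl(L ∪ {x})`, then no plane
`P` with `P ∩ T = {a}`, `a ∈ L`, has rank-`3` trace `{a, x, x′}` on `S = T ∪ {x, x′}`. -/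
theorem no_point_plane_of_coplanar (hs : Simple M) {G T L P : Finset α} (hG : G ∈ planes M) (hT : T ⊆ G)
    (hrT : M.eRk (T : Set α) = 3) (hL : L ∈ linesOf M T) {x x' : α} (hx : x ∈ gr M) (hxG : x ∉ G)
    (hcop : x' ∈ clF M (insert x L)) (hP : P ∈ planes M)
    (hr3 : M.eRk (((insert x (insert x' T)) ∩ P : Finset α) : Set α) = 3) {a : α} (haL : a ∈ L)
    (hSP : (insert x (insert x' T)) ∩ P = insert a {x, x'}) (hPT : (P ∩ T).card ≤ 1) : False := by
  have hL' : L ∈ lines M := (Finset.mem_filter.1 hL).1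
  have hLG := linesOf_subset_plane hs hG hT hrT hL
  have hc' : 2 ≤ L.card := (Finset.mem_filter.1 hL).2.trans (Finset.card_le_card Finset.inter_subset_left)
  have hr₀ : M.eRk ((insert x L : Finset α) : Set α) = 3 :=
    eRk_insert_eq_three hs hL' (Finset.Subset.refl _) hc' hx (fun h => hxG (hLG h))
  have hsub₀ : insert x L ⊆ gr M := Finset.insert_subset hx ((mem_lines.1 hL').1)
  obtain ⟨hP₀, hP₀sub⟩ := clF_mem_planes hsub₀ hr₀
  -- `{a, x, x′} ⊆ P₀ := cl(L ∪ {x})`, of rank `3` (it is the trace `S ∩ P`), so `P = P₀`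
  have hr3' : M.eRk ((insert a {x, x'} : Finset α) : Set α) = 3 := by
    rw [← hSP]
    exact hr3
  have hsubP : insert a {x, x'} ⊆ P := by rw [← hSP]; exact Finset.inter_subset_right
  have hsubP₀ : insert a {x, x'} ⊆ clF M (insert x L) := by
    intro y hy
    simp only [Finset.mem_insert, Finset.mem_singleton] at hy
    rcases hy with rfl | rfl | rfl
    · exact hP₀sub (Finset.mem_insert_of_mem haL)
    · exact hP₀sub (Finset.mem_insert_self _ _)
    · exact hcop
  have hPeq : P = clF M (insert x L) := planes_eq_of_subset hP hP₀ hsubP hsubP₀ hr3'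
  -- but then `P ∩ T ⊇ L ∩ T` has two points
  have hLP : L ⊆ P := by rw [hPeq]; exact (Finset.subset_insert _ _).trans hP₀sub
  have h2 : 2 ≤ (P ∩ T).card :=
    (Finset.mem_filter.1 hL).2.trans (Finset.card_le_card (Finset.inter_subset_inter hLP (Finset.Subset.refl _)))
  omega


end SixThree

end PercRepro
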